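import Literature.AnabelianGeometry.AbsoluteAnabelian.RelativeGrothendieckConjecture
import HarnessLib

/-!
# [AbsTopI] Def 4.6 (chain-full classes of construction data; rel-isom-DGC / rel-hom-DGC) and
# Example 4.8 (hyperbolic orbicurves over (generalized) sub-`p`-adic fields)

S. Mochizuki, *Topics in Absolute Anabelian Geometry I: Generalities* [AbsTopI], §4 pp. 55–58
(manuscript pagination, lit key `paper:url-11ac98ba15fc`).  Definition 4.6 (i)(ii) is the
HYPOTHESIS "`𝒟` is chain-full and the rel-isom-DGC holds" of [AbsTopI] Thm 4.7, [AbsTopII]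
Cor 3.3 / 3.4 / 3.7 / 3.8 (elliptic and Belyi cuspidalization) and hence of [AbsTopIII] Thm 1.9;
Example 4.8 (i)/(ii) verifies it for hyperbolic orbicurves over generalized sub-`p`-adic (resp.
sub-`p`-adic) fields from [Tpcs] Thm 4.12 / Lem 4.14 (resp. [pGC] Thm A / Lem 15.8), typed in
`RelativeGrothendieckConjecture.lean`.  Chain audit: `plan/L4/LC1-CHAIN.md` (abc-iut), links L1d/L1f.

## Typing (cell ruling θ, shape (M))

A "set `𝒟 ⊆ 𝕍 × 𝔽 × 𝕊` of collections of partial construction data" quantifies over algebraic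
stacks and fields, i.e. over the scheme side that the tree does not have (FOUNDATIONS row 12); it is
typed as an INTERFACE `ConstructionDataClass`: a family of base fields `k_b` (REAL fields), for each
of them a `RelativeAnabelianDatum` over `Γ_{k_b} = absoluteGaloisGrp k_b` (objects `X`, their
`Π_X ↠ Γ_{k_b}`, base-morphisms and the natural map `f ↦ [π₁(f)]`), a membership predicate
"`([X],[k_b],Σ_b) ∈ 𝒟`", and — for chain-fullness, Def 4.6 (i) — the scheme-side datum "the
`(X_j, k_j)` occurring in `X̃/X`-chains" as an abstract field quoting print.  The rel-isom/hom-DGC are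
typed slice-wise over each base field (`ζ_k = id`), which is the form [Tpcs] Thm 4.12 / [pGC] Thm A
deliver and [AbsTopII] Cor 3.4 / 3.8 use.
-- TODO(general form): Def 4.6 (ii) allows an isomorphism of fields `ζ_k : k₁ ≅ k₂` and compares
`Isom_{k₁,k₂}(X₁,X₂)` with outer isomorphisms lying over the induced outer `ζ_G : G₁ ≅ G₂`; the
`ζ_k ≠ id` case (reducible to `ζ_k = id` by transport of structure) is not typed — classes should be
built with ONE base index per isomorphism class of construction-data fields (members over isomorphic
fields transported to the representative), for which the slice-wise form is the printed one.
-- TODO(general form): Example 4.8 (ii) is typed in the special case `Σ = Primes` (`IsEx48ClassSub`,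
matching the profinite `pGC.ThmA`); the pro-`Σ` form (`𝕊` = subsets of Primes containing `p`), needed
for the pro-`Σ` versions of Thm 4.7 (iii)/(iv), is to be filed with the pro-`p` form of Thm A.
Reviews q9944445 / q9943279: `𝕍` = hyperbolic ORBIcurves as printed (class field `IsHyperbolicOrbicurve`,
containing the datum's hyperbolic curves — the GC theorems of `RelativeGrothendieckConjecture.lean` cover
the curve members only); Example 4.8's conclusion is typed with all FOUR printed clauses (chain-full, GC,
"`p` serves as the prime `l`" = `χ_p` open image, slim); Example 4.8 (ii) is the special case `Σ = Primes`.
A junk class falsifies only its own instance; typed ≠ discharged; no side taken on any disputed claim.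
-/

open CategoryTheory Topology

universe u

namespace Literature.AnabelianGeometry.AbsoluteAnabelian.AbsTopI

open Literature.AlgebraicGeometry.Frobenioids (IsSlimGroup)
open AugmentedProfiniteGrp

/-- [AbsTopI] Definition 4.6 (i) p. 55, INTERFACE form: "Let `𝕍` (respectively, `𝔽`; `𝕊`) be a set
of isomorphism classes of algebraic stacks (respectively, set of isomorphism classes of fields; set of
nonempty subsets of Primes); `𝒟 ⊆ 𝕍 × 𝔽 × 𝕊` [...] a set of collections of partial construction
data."  Here: an index type of base fields `k_b` (real fields of characteristic zero), for each `b` a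
relative anabelian datum over `Γ_{k_b}` (whose `primes` is the `Σ` of the triples with field `k_b`),
the membership predicate `Mem b X` = "`([X],[k_b],Σ) ∈ 𝒟`", the predicate "is a hyperbolic orbicurve"
(the printed `𝕍` of Example 4.8 consists of hyperbolic ORBIcurves; chains of type ⋎ leave the class of
curves, Def 4.2 (i) (3X) p. 47 / Ex 4.4 p. 52), and the scheme-side datum `chainTerms`
= "the `X_j, k_j` [cf. Definition 4.2, (i)] appearing in an `X̃/X`-chain" (as pairs `(b', X')`),
which only the étale-`π₁` instance can fill in. [cite: MochizukiAbsTopI2012, Def 4.6 (i) p.55] -/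
structure ConstructionDataClass : Type (u + 2) where
  /-- indices `b` of the construction-data fields `k_b` (one per pair `(k, Σ)`) -/
  Base : Type u
  /-- the construction-data field `k_b` -/
  fld : Base → Type u
  /-- `k_b` is a field -/
  instField : ∀ b, Field (fld b)
  /-- `k_b` has characteristic zero -/
  instCharZero : ∀ b, CharZero (fld b)
  /-- the objects over `k_b` with their `Π_X ↠ Γ_{k_b}` and the natural map `f ↦ [π₁(f)]` -/
  datum : ∀ b, RelativeAnabelianDatum (@absoluteGaloisGrp (fld b) (instField b) (instCharZero b))
  /-- "`([X],[k_b],Σ_b) ∈ 𝒟`" -/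
  Mem : ∀ b, (datum b).Obj → Prop
  /-- the objects that are hyperbolic ORBIcurves over `k_b` (algebraic stacks; [AbsTopI] §0, Def 4.2
  (i) (3X) p. 47) — the datum's `IsHyperbolicCurve` flags the hyperbolic curves among them -/
  IsHyperbolicOrbicurve : ∀ b, (datum b).Obj → Prop
  /-- a hyperbolic curve is a hyperbolic orbicurve -/
  isHyperbolicOrbicurve_of_isHyperbolicCurve :
    ∀ b X, (datum b).IsHyperbolicCurve X → IsHyperbolicOrbicurve b X
  /-- the `(k_j, X_j)` occurring as terms of `X̃/X`-chains starting at the member `X` (Def 4.2 (i)) -/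
  chainTerms : ∀ b, (datum b).Obj → Set (Σ b', (datum b').Obj)

namespace ConstructionDataClass

attribute [instance] ConstructionDataClass.instField ConstructionDataClass.instCharZero

variable (𝒟 : ConstructionDataClass.{u})

/-- [AbsTopI] Definition 4.6 (i) p. 55: "We shall say that `𝒟` is *chain-full* if for every extension
[...] of GSAFG-type [...] that admits base-prime partial construction data `(X, k, Σ)` such that
`([X],[k],Σ) ∈ 𝒟`, it follows that every `X_j, k_j` appearing in an `X̃/X`-chain determines an
element `([X_j],[k_j],Σ) ∈ 𝒟`" — with the SAME prime set `Σ` as the member one started from: each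
chain term is again a member AND its slice carries the same `Σ`.  (Print asks this only of extensions
"where `G` is slim"; the typed predicate asks it of every member — equivalent for the classes of
Example 4.8, where every `G_{k_b}` is slim by [Tpcs] Lem 4.14 / [pGC] Lem 15.8, and harmlessly stronger
otherwise.) [cite: MochizukiAbsTopI2012, Def 4.6 (i) p.55] -/
def IsChainFull : Prop :=
  ∀ (b : 𝒟.Base) (X : (𝒟.datum b).Obj), 𝒟.Mem b X →
    ∀ t ∈ 𝒟.chainTerms b X, 𝒟.Mem t.1 t.2 ∧ (𝒟.datum t.1).primes = (𝒟.datum b).primes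

/-- [AbsTopI] Definition 4.6 (ii) p. 55–56, "the *rel-isom-DGC holds*" [i.e., "the relative
isomorphism version of the GC for `𝒟` holds"]: for `i = 1, 2` and extensions of GSAFG-type with
base-prime partial construction data `(k_i, X_i, Σ_i)` in `𝒟` [...] "the natural map
`Isom_{k₁,k₂}(X₁, X₂) → Isom^{out}_{G₁,G₂}(Π₁, Π₂)` [...] is a bijection."  Typed slice-wise
(`k₁ = k₂ = k_b`, `ζ_k = id`; see the module docstring for the general form): on members of `𝒟` over
`k_b`, `f ↦ [π₁(f)]` restricts to a bijection from the isomorphisms onto the outer isomorphisms over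
`Γ_{k_b}` modulo `Δ`-inner automorphisms. [cite: MochizukiAbsTopI2012, Def 4.6 (ii) p.56] -/
def RelIsomDGC : Prop :=
  ∀ (b : 𝒟.Base) (X₁ X₂ : (𝒟.datum b).Obj), 𝒟.Mem b X₁ → 𝒟.Mem b X₂ →
    Set.BijOn ((𝒟.datum b).outerHom (X := X₁) (Y := X₂)) {f | (𝒟.datum b).IsIso f} {c | c.IsIso}

/-- [AbsTopI] Definition 4.6 (ii) p. 55–56, "the *rel-hom-DGC holds*" [i.e., "the relative
homomorphism version of the GC for `𝒟` holds"]: "the natural map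
`Hom^{dom}_{k₁,k₂}(X₁, X₂) → Hom^{out-open}_{G₁,G₂}(Π₁, Π₂)` [from the set of dominant morphisms
[...] to the set of open outer homomorphisms of profinite groups `Π₁ → Π₂` lying over `ζ_G`] is a
bijection" — slice-wise form as for `RelIsomDGC`. [cite: MochizukiAbsTopI2012, Def 4.6 (ii) p.56] -/
def RelHomDGC : Prop :=
  ∀ (b : 𝒟.Base) (X₁ X₂ : (𝒟.datum b).Obj), 𝒟.Mem b X₁ → 𝒟.Mem b X₂ →
    Set.BijOn ((𝒟.datum b).outerHom (X := X₁) (Y := X₂)) Set.univ {c | c.IsOpen}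

/-! ### [AbsTopI] Example 4.8: hyperbolic orbicurves over (generalized) sub-`p`-adic fields -/

/-- The class `𝒟 = 𝕍 × 𝔽 × 𝕊` of [AbsTopI] Example 4.8 (i) p. 58 as a property of an abstract class:
"`p` a prime number; `𝕊` the set of subsets of Primes containing `p`; `𝕍` the set of isomorphism
classes of hyperbolic orbicurves over fields of cardinality ≤ the cardinality of `ℚ_p`"; "(i) Let `𝔽`
be the set of isomorphism classes of generalized sub-`p`-adic fields".  Here: every `k_b` is
generalized sub-`p`-adic, `p ∈ Σ_b`, and the members over `k_b` are exactly the hyperbolic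
ORBIcurves of the class (`IsHyperbolicOrbicurve`, as printed; the GC theorems `Tpcs.Thm_4_12` /
`pGC.ThmA` of `RelativeGrothendieckConjecture.lean` are typed for the hyperbolic CURVES among them, so
they supply the GC clause only on curve members — `relIsomGC_curves_of_thm_4_12`); the cardinality
bound (a set-theoretic convenience) is omitted. [cite: MochizukiAbsTopI2012, Ex 4.8 (i) p.58] -/
structure IsEx48ClassGen (p : ℕ) [Fact p.Prime] : Prop where
  /-- every construction-data field is generalized sub-`p`-adic -/
  generalizedSubpadic : ∀ b, AbsTopIII.IsGeneralizedSubpadicFor (𝒟.fld b) p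
  /-- `p ∈ Σ` -/
  mem_primes : ∀ b, p ∈ (𝒟.datum b).primes
  /-- the members are exactly the hyperbolic orbicurves -/
  mem_iff : ∀ b X, 𝒟.Mem b X ↔ 𝒟.IsHyperbolicOrbicurve b X

/-- The class of [AbsTopI] Example 4.8 (ii) p. 58: as in (i) but "(ii) Let `𝔽` be the set of
isomorphism classes of sub-`p`-adic fields", and `Σ` = all primes for the profinite statement of
[pGC] Thm A used there — the SPECIAL CASE `Σ = Primes` of the printed `𝕊` = "subsets of Primes
containing `p`" (the pro-`Σ` refinement is not typed — cf. `pGC.ThmA`); members = hyperbolic orbicurves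
as in `IsEx48ClassGen`. [cite: MochizukiAbsTopI2012, Ex 4.8 (ii) p.58] -/
structure IsEx48ClassSub (p : ℕ) [Fact p.Prime] : Prop where
  /-- every construction-data field is sub-`p`-adic -/
  subpadic : ∀ b, AbsTopIII.IsSubpadicFor (𝒟.fld b) p
  /-- `Σ = Primes` -/
  primes_eq : ∀ b, (𝒟.datum b).primes = Set.univ
  /-- the members are exactly the hyperbolic orbicurves -/
  mem_iff : ∀ b X, 𝒟.Mem b X ↔ 𝒟.IsHyperbolicOrbicurve b X

/-- **[AbsTopI] Example 4.8 (i)** p. 58: for the class of hyperbolic orbicurves over generalized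
sub-`p`-adic fields with `p ∈ Σ` (`IsEx48ClassGen`), "The hypotheses
of Theorem 4.7, (i), (ii), are satisfied relative to this `𝒟`.  Indeed, it is immediate that `𝒟` is
chain-full; the rel-isom-DGC follows from [Tpcs], Theorem 4.12; the prime `p` clearly serves as a
prime '`l`' as in the statement of Theorem 4.7 [= Thm 4.7 (b): the cyclotomic character
`G → ℤ_p^×` has open image].  Moreover, we recall from [Tpcs], Lemma 4.14, that the absolute Galois
group of a generalized sub-`p`-adic field is always slim."  FOUR clauses typed: chain-full ∧
rel-isom-DGC ∧ `χ_p : G_{k_b} → ℤ_p^×` open image (the cell's `AbsTopIII.cyclotomicChar`) ∧ `G_{k_b}`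
slim.  Named fact (shape (M)); its GC clause ON CURVE MEMBERS is a formal consequence of
`Tpcs.Thm_4_12` (`relIsomGC_curves_of_thm_4_12`; the orbicurve case stays inside the fact), its slimness
clause of `Tpcs.Lem_4_14_slim`. [cite: MochizukiAbsTopI2012, Ex 4.8 (i) p.58] -/
def Ex_4_8_i (p : ℕ) [Fact p.Prime] : Prop :=
  𝒟.IsEx48ClassGen p →
    𝒟.IsChainFull ∧ 𝒟.RelIsomDGC ∧
      (∀ b, IsOpen (Set.range (AbsTopIII.cyclotomicChar (𝒟.fld b) p))) ∧
      ∀ b, IsSlimGroup (Field.absoluteGaloisGroup (𝒟.fld b))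

/-- **[AbsTopI] Example 4.8 (ii)** p. 58, SPECIAL CASE `Σ = Primes` (`IsEx48ClassSub`): for the class
of hyperbolic orbicurves over sub-`p`-adic fields, "The hypotheses of Theorem 4.7, (iii), (iv),
are satisfied relative to this `𝒟`.  Indeed, it is immediate that `𝒟` is chain-full; the rel-hom-DGC
follows from [pGC], Theorem A; the prime `p` clearly serves as a prime '`l`' as in the statement of
Theorem 4.7.  Moreover, we recall from [pGC], Lemma 15.8, that the absolute Galois group of a
sub-`p`-adic field is always slim."  FOUR clauses typed as in `Ex_4_8_i`.  Named fact (shape (M));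
GC clause on curve members from `pGC.ThmA` (`relHomGC_curves_of_thmA`), slimness from
`pGC.Lem_15_8_slim`, the cyclotomic clause from [AbsTopIII] Rmk 1.5.4 (i) + Rmk 1.5.1
(`cyclotomic_of_rmk_1_5_4_i`). [cite: MochizukiAbsTopI2012, Ex 4.8 (ii) p.58] -/
def Ex_4_8_ii (p : ℕ) [Fact p.Prime] : Prop :=
  𝒟.IsEx48ClassSub p →
    𝒟.IsChainFull ∧ 𝒟.RelHomDGC ∧
      (∀ b, IsOpen (Set.range (AbsTopIII.cyclotomicChar (𝒟.fld b) p))) ∧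
      ∀ b, IsSlimGroup (Field.absoluteGaloisGroup (𝒟.fld b))

variable {𝒟}

/-- The GC clause of Example 4.8 (i) ON HYPERBOLIC CURVES is [Tpcs] Theorem 4.12 applied field by
field ("the rel-isom-DGC follows from [Tpcs], Theorem 4.12", p. 58; the orbicurve members are not
covered by `Tpcs.Thm_4_12` as typed and stay inside the named fact). [cite: MochizukiAbsTopI2012, Ex 4.8 (i) p.58] -/
theorem relIsomGC_curves_of_thm_4_12 {p : ℕ} [Fact p.Prime] (h𝒟 : 𝒟.IsEx48ClassGen p)
    (hGC : ∀ b, Tpcs.Thm_4_12 p (𝒟.fld b) (𝒟.datum b)) (b : 𝒟.Base) (X₁ X₂ : (𝒟.datum b).Obj)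
    (h₁ : (𝒟.datum b).IsHyperbolicCurve X₁) (h₂ : (𝒟.datum b).IsHyperbolicCurve X₂) :
    Set.BijOn ((𝒟.datum b).outerHom (X := X₁) (Y := X₂)) {f | (𝒟.datum b).IsIso f} {c | c.IsIso} :=
  hGC b (h𝒟.generalizedSubpadic b) (h𝒟.mem_primes b) X₁ X₂ h₁ h₂

/-- The GC clause of Example 4.8 (ii) on hyperbolic curves is [pGC] Theorem A applied field by field
("the rel-hom-DGC follows from [pGC], Theorem A", p. 58). [cite: MochizukiAbsTopI2012, Ex 4.8 (ii) p.58] -/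
theorem relHomGC_curves_of_thmA {p : ℕ} [Fact p.Prime] (h𝒟 : 𝒟.IsEx48ClassSub p)
    (hGC : ∀ b, pGC.ThmA (𝒟.fld b) (𝒟.datum b)) (b : 𝒟.Base) (X₁ X₂ : (𝒟.datum b).Obj)
    (h₂ : (𝒟.datum b).IsHyperbolicCurve X₂) :
    Set.BijOn ((𝒟.datum b).outerHom (X := X₁) (Y := X₂)) Set.univ {c | c.IsOpen} :=
  hGC b ⟨⟨p, inferInstance, h𝒟.subpadic b⟩⟩ (h𝒟.primes_eq b) X₁ X₂ h₂

/-- The slimness clause of Example 4.8 (i) IS [Tpcs] Lemma 4.14 (slim form) field by field.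
[cite: MochizukiAbsTopI2012, Ex 4.8 (i) p.58] -/
theorem slim_of_lem_4_14 {p : ℕ} [Fact p.Prime] (h𝒟 : 𝒟.IsEx48ClassGen p)
    (hslim : Tpcs.Lem_4_14_slim.{u}) (b : 𝒟.Base) :
    IsSlimGroup (Field.absoluteGaloisGroup (𝒟.fld b)) :=
  hslim (𝒟.fld b) p (h𝒟.generalizedSubpadic b)

/-- The slimness clause of Example 4.8 (ii) IS [pGC] Lemma 15.8 (slim form) field by field.
[cite: MochizukiAbsTopI2012, Ex 4.8 (ii) p.58] -/
theorem slim_of_lem_15_8 {p : ℕ} [Fact p.Prime] (h𝒟 : 𝒟.IsEx48ClassSub p)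
    (hslim : pGC.Lem_15_8_slim.{u}) (b : 𝒟.Base) :
    IsSlimGroup (Field.absoluteGaloisGroup (𝒟.fld b)) :=
  hslim (𝒟.fld b) ⟨⟨p, inferInstance, h𝒟.subpadic b⟩⟩

/-- The cyclotomic clause of Example 4.8 (ii) ("the prime `p` clearly serves as a prime `l`": for
sub-`p`-adic `k`, `χ_p : G_k → ℤ_p^×` has open image) follows from [AbsTopIII] Rmk 1.5.4 (i)
(sub-`p`-adic ⇒ Kummer-faithful) and Rmk 1.5.1 (torally Kummer-faithful ⇒ `χ_l` open), the cell's
named facts `AbsTopIII.Rmk_1_5_4_i` / `AbsTopIII.Rmk_1_5_1`. [cite: MochizukiAbsTopI2012, Ex 4.8 (ii) p.58] -/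
theorem cyclotomic_of_rmk_1_5_4_i {p : ℕ} [Fact p.Prime] (h𝒟 : 𝒟.IsEx48ClassSub p)
    (h154 : AbsTopIII.Rmk_1_5_4_i.{u}) (h151 : AbsTopIII.Rmk_1_5_1.{u}) (b : 𝒟.Base) :
    IsOpen (Set.range (AbsTopIII.cyclotomicChar (𝒟.fld b) p)) :=
  h151 (𝒟.fld b) (h154 (𝒟.fld b) ⟨⟨p, inferInstance, h𝒟.subpadic b⟩⟩).isTorallyKummerFaithful p

/-- Hence Example 4.8 (i) reduces to its chain-fullness clause ("it is immediate that `𝒟` is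
chain-full" — a property of the scheme-side chains, which stay abstract here), its GC clause (for curve
members = `relIsomGC_curves_of_thm_4_12`; for general orbicurves an input) and its cyclotomic clause
(`χ_p` open for generalized sub-`p`-adic fields — not Kummer-faithful in general, [AbsTopIII] Rmk 1.5.4
(iv), so not obtainable from Rmk 1.5.1; an input), given [Tpcs] Lem 4.14. [cite: MochizukiAbsTopI2012, Ex 4.8 (i) p.58] -/
theorem ex_4_8_i_of {p : ℕ} [Fact p.Prime] (hfull : 𝒟.IsChainFull) (hGC : 𝒟.RelIsomDGC)
    (hslim : Tpcs.Lem_4_14_slim.{u})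
    (hcyc : ∀ b, IsOpen (Set.range (AbsTopIII.cyclotomicChar (𝒟.fld b) p))) :
    𝒟.Ex_4_8_i p :=
  fun h𝒟 => ⟨hfull, hGC, hcyc, slim_of_lem_4_14 h𝒟 hslim⟩

/-- Hence Example 4.8 (ii) reduces to its chain-fullness clause and its GC clause (curve members:
`relHomGC_curves_of_thmA`) once [pGC] Lem 15.8 and [AbsTopIII] Rmk 1.5.4 (i) / Rmk 1.5.1 are available.
[cite: MochizukiAbsTopI2012, Ex 4.8 (ii) p.58] -/
theorem ex_4_8_ii_of {p : ℕ} [Fact p.Prime] (hfull : 𝒟.IsChainFull) (hGC : 𝒟.RelHomDGC)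
    (hslim : pGC.Lem_15_8_slim.{u}) (h154 : AbsTopIII.Rmk_1_5_4_i.{u}) (h151 : AbsTopIII.Rmk_1_5_1.{u}) :
    𝒟.Ex_4_8_ii p :=
  fun h𝒟 => ⟨hfull, hGC, cyclotomic_of_rmk_1_5_4_i h𝒟 h154 h151, slim_of_lem_15_8 h𝒟 hslim⟩

end ConstructionDataClass

end Literature.AnabelianGeometry.AbsoluteAnabelian.AbsTopI
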